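import Literature.MathematicalPhysics.QuantumLattice.HubbardModel

/-!
# Crux `TwSeededEnsembleEquivalenceR` (stmt-HubbardSuperconductivity-15581), line `cold-floor-collapse`
# (slug `Sketch`) — stub S3 `stub_sourcedPressureLimit`, layer 3: block geometry of the vertex sets
# `Λ_N = FermionTorus 2 N`

Support file (`--supports stmt-HubbardSuperconductivity-15581`; sorry-free; no definition; no operator
algebra). The vertex sets `Λ_N = Lex (Fin 2 → Fin N)` of the tree's fermionic tori carry natural
coordinates `X_j = (ofLex X j : ℕ)`; all relations are written inline:

* the free-boundary step `st_N i X Y :↔ (Y_j)_j = (X_j)_j + e_i` (as functions `Fin 2 → ℕ`) and the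
  periodic step `tst_N i X Y :↔ toTorusSite Y = toTorusSite X + e_i` (in `(ℤ/N)²`);
* **block embeddings** `f : Λ_M ↪o Λ_N`, `X ↦ p + X` (`exists_blockEmb`), their images = the boxes
  `p + [0,M)²` (`mem_map_blockEmb_iff`), covariance of `st` (`step_blockEmb_iff`); for `N = KM` the fibres
  of the block map `X ↦ (X₀/M, X₁/M)` are images of block embeddings (`filter_blk_eq_map`);
* `st` is a partial bijection (`step_right_unique`, `step_left_unique`), `st ⇒ tst`, and a periodic step
  that is not a free step starts on the seam `X_i = N − 1` (`coord_eq_of_tstep_of_not_step`); a step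
  leaving its block starts at `X_i ≡ −1 (mod M)` (`dvd_of_step_of_blk_ne`);
* counting: `#{X | P(X_i)} ≤ N·#{a < N | P a}`, `#{a < KM | M ∣ a+1} ≤ K`, `#{a < N | a + 1 = N} ≤ 1`;
* periodic sums as indicator sums: `Σ_{x ∈ (ℤ/N)²} F(x, x + e_i) = Σ_X Σ_Y [tst_N i X Y] F(X, Y)`.

Ruelle, *Statistical Mechanics* (1969) §2.2 (boxes, van Hove boundary counts). [folklore]
-/

-- the mandated namespace `Summit.<Summit>.<Problem>.Theorems…` repeats `HubbardSuperconductivity`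
set_option linter.dupNamespace false

namespace Summit.HubbardSuperconductivity.HubbardSuperconductivity.Theorems.TwSeededEnsembleEquivalenceR.ColdFloorLine

open Finset Literature.MathematicalPhysics.QuantumLattice Literature.Probability.LatticeModels

/-! ### Coordinates, cardinalities, block embeddings -/

/-- Sites of `Λ_N` are determined by their natural coordinates. [folklore] -/
theorem fermionTorus_ext {N : ℕ} {X Y : FermionTorus 2 N} (h : ∀ j, (ofLex X j : ℕ) = (ofLex Y j : ℕ)) :
    X = Y := by
  have : ofLex X = ofLex Y := funext fun j => Fin.ext (h j)
  simpa using this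

/-- `|Orb Λ_N| = 2N²`. [folklore] -/
theorem card_orb_fermionTorus_two (N : ℕ) : Fintype.card (Orb (FermionTorus 2 N)) = 2 * N ^ 2 := by
  simp only [Orb, Fintype.card_lex, Fintype.card_prod, Fintype.card_fin, FermionTorus, Fintype.card_pi,
    Finset.prod_const, Finset.card_univ]
  ring

/-- **Block embeddings.** For offsets `p` with `p_j + M ≤ N` there is an order embedding
`f : Λ_M ↪o Λ_N` (lexicographic orders) acting as the translation `X ↦ p + X` on coordinates.
[folklore] -/
theorem exists_blockEmb {M N : ℕ} (p : Fin 2 → ℕ) (hp : ∀ j, p j + M ≤ N) :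
    ∃ f : FermionTorus 2 M ↪o FermionTorus 2 N, ∀ X j, (ofLex (f X) j : ℕ) = p j + (ofLex X j : ℕ) := by
  let g : FermionTorus 2 M → FermionTorus 2 N := fun X =>
    toLex fun j => ⟨p j + (ofLex X j : ℕ), by have := (ofLex X j).isLt; have := hp j; omega⟩
  have hg : ∀ X j, (ofLex (g X) j : ℕ) = p j + (ofLex X j : ℕ) := fun X j => rfl
  have hmono : StrictMono g := by
    intro X Y hXY
    obtain ⟨i, hi, hlt⟩ := hXY
    refine ⟨i, fun j hj => ?_, ?_⟩
    · have := hi j hj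
      apply Fin.ext
      change p j + (ofLex X j : ℕ) = p j + (ofLex Y j : ℕ)
      rw [show ofLex X j = ofLex Y j from this]
    · change (⟨p i + (ofLex X i : ℕ), _⟩ : Fin N) < ⟨p i + (ofLex Y i : ℕ), _⟩
      rw [Fin.mk_lt_mk]
      have : (ofLex X i : ℕ) < (ofLex Y i : ℕ) := hlt
      omega
  exact ⟨OrderEmbedding.ofStrictMono g hmono, hg⟩

/-- **The image of a block embedding is the box `p + [0, M)²`.** [folklore] -/
theorem mem_map_blockEmb_iff {M N : ℕ} {p : Fin 2 → ℕ} {f : FermionTorus 2 M ↪o FermionTorus 2 N}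
    (hf : ∀ X j, (ofLex (f X) j : ℕ) = p j + (ofLex X j : ℕ)) (X' : FermionTorus 2 N) :
    X' ∈ (Finset.univ : Finset (FermionTorus 2 M)).map f.toEmbedding ↔
      ∀ j, p j ≤ (ofLex X' j : ℕ) ∧ (ofLex X' j : ℕ) < p j + M := by
  constructor
  · intro h
    obtain ⟨X, -, rfl⟩ := Finset.mem_map.1 h
    intro j
    have h1 := hf X j
    have h2 := (ofLex X j).isLt
    change p j ≤ (ofLex (f X) j : ℕ) ∧ (ofLex (f X) j : ℕ) < p j + M
    omega
  · intro h
    refine Finset.mem_map.2 ⟨toLex fun j => ⟨(ofLex X' j : ℕ) - p j, by have := h j; omega⟩,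
      Finset.mem_univ _, ?_⟩
    refine fermionTorus_ext fun j => ?_
    change (ofLex (f _) j : ℕ) = _
    rw [hf]
    change p j + ((ofLex X' j : ℕ) - p j) = (ofLex X' j : ℕ)
    have := h j
    omega

/-- The image of a block embedding has `M²` of the `N²` sites: `N² − #f(Λ_M) = N² − M²` (real form).
[folklore] -/
theorem card_sub_card_map_blockEmb {M N : ℕ} (f : FermionTorus 2 M ↪o FermionTorus 2 N) :
    ((Fintype.card (FermionTorus 2 N) - ((Finset.univ : Finset (FermionTorus 2 M)).map f.toEmbedding).card : ℕ) : ℝ) =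
      (N : ℝ) ^ 2 - (M : ℝ) ^ 2 := by
  have hc : ∀ L : ℕ, Fintype.card (FermionTorus 2 L) = L ^ 2 := fun L => by simp [FermionTorus, Fintype.card_lex]
  have hle : M ^ 2 ≤ N ^ 2 := by
    have := Fintype.card_le_of_embedding f.toEmbedding
    rwa [hc, hc] at this
  rw [Finset.card_map, Finset.card_univ, hc, hc, Nat.cast_sub hle]
  push_cast
  ring

/-! ### The free-boundary step relation -/

/-- The step relation `Y = X + e_i` (natural coordinates) is translation covariant. [folklore] -/
theorem step_blockEmb_iff {M N : ℕ} {p : Fin 2 → ℕ} {f : FermionTorus 2 M ↪o FermionTorus 2 N}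
    (hf : ∀ X j, (ofLex (f X) j : ℕ) = p j + (ofLex X j : ℕ)) (i : Fin 2) (X Y : FermionTorus 2 M) :
    (Fin.val ∘ ofLex (f Y)) = (Fin.val ∘ ofLex (f X)) + Pi.single i 1 ↔
      (Fin.val ∘ ofLex Y) = (Fin.val ∘ ofLex X) + Pi.single i 1 := by
  simp only [funext_iff, Function.comp_apply, Pi.add_apply, hf]
  exact forall_congr' fun j => by omega

/-- Coordinates of a step: `Y_i = X_i + 1` and `Y_j = X_j` for `j ≠ i`. [folklore] -/
theorem coord_of_step {N : ℕ} {i : Fin 2} {X Y : FermionTorus 2 N}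
    (h : (Fin.val ∘ ofLex Y) = (Fin.val ∘ ofLex X) + Pi.single i 1) (j : Fin 2) :
    (ofLex Y j : ℕ) = (ofLex X j : ℕ) + if j = i then 1 else 0 := by
  have := congrFun h j
  simp only [Function.comp_apply, Pi.add_apply, Pi.single_apply] at this
  exact this

/-- Steps are right-unique. [folklore] -/
theorem step_right_unique {N : ℕ} (i : Fin 2) (X Y Y' : FermionTorus 2 N)
    (h : (Fin.val ∘ ofLex Y) = (Fin.val ∘ ofLex X) + Pi.single i 1)
    (h' : (Fin.val ∘ ofLex Y') = (Fin.val ∘ ofLex X) + Pi.single i 1) : Y = Y' :=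
  fermionTorus_ext fun j => by rw [coord_of_step h, coord_of_step h']

/-- Steps are left-unique. [folklore] -/
theorem step_left_unique {N : ℕ} (i : Fin 2) (X X' Y : FermionTorus 2 N)
    (h : (Fin.val ∘ ofLex Y) = (Fin.val ∘ ofLex X) + Pi.single i 1)
    (h' : (Fin.val ∘ ofLex Y) = (Fin.val ∘ ofLex X') + Pi.single i 1) : X = X' :=
  fermionTorus_ext fun j => by
    have h1 := coord_of_step h j
    have h2 := coord_of_step h' j
    omega

/-! ### Blocks of side `M` in `Λ_{KM}` -/

/-- The block map `X ↦ (X₀/M, X₁/M)` lands in `[0,K)²` when `N = KM`. [folklore] -/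
theorem blk_mem_range {K M N : ℕ} (hN : N = K * M) (X : FermionTorus 2 N) :
    (((ofLex X 0 : ℕ) / M, (ofLex X 1 : ℕ) / M) : ℕ × ℕ) ∈ Finset.range K ×ˢ Finset.range K := by
  rw [Finset.mem_product, Finset.mem_range, Finset.mem_range]
  have h0 : (ofLex X 0 : ℕ) < M * K := ((ofLex X 0).isLt.trans_eq hN).trans_eq (mul_comm K M)
  have h1 : (ofLex X 1 : ℕ) < M * K := ((ofLex X 1).isLt.trans_eq hN).trans_eq (mul_comm K M)
  exact ⟨Nat.div_lt_of_lt_mul h0, Nat.div_lt_of_lt_mul h1⟩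

/-- **A step leaving its block starts at `X_i ≡ −1 (mod M)`.** [folklore] -/
theorem dvd_of_step_of_blk_ne {N M : ℕ} (i : Fin 2) (X Y : FermionTorus 2 N)
    (h : (Fin.val ∘ ofLex Y) = (Fin.val ∘ ofLex X) + Pi.single i 1)
    (hne : (((ofLex X 0 : ℕ) / M, (ofLex X 1 : ℕ) / M) : ℕ × ℕ) ≠ (((ofLex Y 0 : ℕ) / M, (ofLex Y 1 : ℕ) / M))) :
    M ∣ (ofLex X i : ℕ) + 1 := by
  by_contra hd
  have key : ((ofLex X i : ℕ) + 1) / M = (ofLex X i : ℕ) / M := by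
    rw [Nat.succ_div, if_neg hd, add_zero]
  apply hne
  have hc : ∀ j, (ofLex Y j : ℕ) / M = (ofLex X j : ℕ) / M := by
    intro j
    rw [coord_of_step h j]
    by_cases hji : j = i
    · subst hji; rw [if_pos rfl, key]
    · rw [if_neg hji, add_zero]
  rw [hc 0, hc 1]

/-- **The blocks are boxes**: for `N = KM` and `c ∈ [0,K)²`, the fibre `{X | (X₀/M, X₁/M) = c}` is the
image of the block embedding with offset `(c₀M, c₁M)`. [folklore] -/
theorem filter_blk_eq_map {M N : ℕ} (hM : 0 < M) {c : ℕ × ℕ}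
    {f : FermionTorus 2 M ↪o FermionTorus 2 N}
    (hf : ∀ X j, (ofLex (f X) j : ℕ) = ![c.1 * M, c.2 * M] j + (ofLex X j : ℕ)) :
    (Finset.univ.filter fun X : FermionTorus 2 N => (((ofLex X 0 : ℕ) / M, (ofLex X 1 : ℕ) / M) : ℕ × ℕ) = c) =
      (Finset.univ : Finset (FermionTorus 2 M)).map f.toEmbedding := by
  ext X
  rw [Finset.mem_filter, mem_map_blockEmb_iff hf, Fin.forall_fin_two, Prod.ext_iff]
  simp only [Finset.mem_univ, true_and, Matrix.cons_val_zero, Matrix.cons_val_one]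
  rw [Nat.div_eq_iff hM, Nat.div_eq_iff hM]
  constructor
  · rintro ⟨⟨h1, h2⟩, ⟨h3, h4⟩⟩; omega
  · rintro ⟨⟨h1, h2⟩, ⟨h3, h4⟩⟩; omega

/-- Offsets of the blocks fit: `c_j M + M ≤ KM` for `c ∈ [0,K)²`. [folklore] -/
theorem blockOffset_le {K M N : ℕ} (hN : N = K * M) {c : ℕ × ℕ} (hc : c ∈ Finset.range K ×ˢ Finset.range K) :
    ∀ j : Fin 2, ![c.1 * M, c.2 * M] j + M ≤ N := by
  rw [Finset.mem_product, Finset.mem_range, Finset.mem_range] at hc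
  intro j
  fin_cases j
  · simp only [Fin.zero_eta, Fin.isValue, Matrix.cons_val_zero, hN]
    nlinarith [hc.1]
  · simp only [Fin.mk_one, Fin.isValue, Matrix.cons_val_one, Matrix.cons_val_zero, hN]
    nlinarith [hc.2]

/-- Distinct fibres of the block map are disjoint. [folklore] -/
theorem disjoint_filter_blk {N M : ℕ} {c c' : ℕ × ℕ} (h : c ≠ c') :
    Disjoint (Finset.univ.filter fun X : FermionTorus 2 N => (((ofLex X 0 : ℕ) / M, (ofLex X 1 : ℕ) / M) : ℕ × ℕ) = c)
      (Finset.univ.filter fun X : FermionTorus 2 N => (((ofLex X 0 : ℕ) / M, (ofLex X 1 : ℕ) / M) : ℕ × ℕ) = c') :=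
  Finset.disjoint_left.2 fun _ hX hX' => h
    ((Finset.mem_filter.1 hX).2.symm.trans (Finset.mem_filter.1 hX').2)

/-! ### Counting -/

/-- **Sites with a prescribed property of one coordinate**: `#{X ∈ Λ_N | P(X_i)} ≤ #{a < N | P a} · N`.
[folklore] -/
theorem card_filter_coord_le (N : ℕ) (i : Fin 2) (P : ℕ → Prop) [DecidablePred P] :
    (Finset.univ.filter fun X : FermionTorus 2 N => P (ofLex X i : ℕ)).card ≤
      (Finset.univ.filter fun a : Fin N => P (a : ℕ)).card * N := by
  have key : (Finset.univ.filter fun X : FermionTorus 2 N => P (ofLex X i : ℕ)).card ≤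
      ((Finset.univ.filter fun a : Fin N => P (a : ℕ)) ×ˢ (Finset.univ : Finset (Fin N))).card := by
    refine Finset.card_le_card_of_injOn (fun X => (ofLex X i, ofLex X (i + 1))) (fun X hX => ?_)
      (fun X _ X' _ hXX' => ?_)
    · rw [Finset.coe_filter] at hX
      simp only [Finset.coe_product, Finset.coe_filter, Finset.coe_univ, Set.mem_prod, Set.mem_setOf_eq,
        Set.mem_univ, and_true]
      exact ⟨Finset.mem_univ _, hX.2⟩
    · simp only [Prod.mk.injEq] at hXX'
      refine fermionTorus_ext fun j => ?_
      by_cases hj : j = i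
      · subst hj; rw [hXX'.1]
      · have : j = i + 1 := by omega
        subst this; rw [hXX'.2]
  refine key.trans ?_
  rw [Finset.card_product, Finset.card_univ, Fintype.card_fin]

/-- `#{a < KM | M ∣ a + 1} ≤ K`. [folklore] -/
theorem card_filter_dvd_succ_le {K M N : ℕ} (hN : N = K * M) :
    (Finset.univ.filter fun a : Fin N => M ∣ (a : ℕ) + 1).card ≤ K := by
  have key : (Finset.univ.filter fun a : Fin N => M ∣ (a : ℕ) + 1).card ≤ (Finset.range K).card := by
    refine Finset.card_le_card_of_injOn (fun a => (a : ℕ) / M) (fun a _ => ?_) (fun a ha a' ha' h => ?_)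
    · rw [Finset.coe_range, Set.mem_Iio]
      have : (a : ℕ) < M * K := (a.isLt.trans_eq hN).trans_eq (mul_comm K M)
      exact Nat.div_lt_of_lt_mul this
    · rw [Finset.coe_filter] at ha ha'
      have h1 : (a : ℕ) % M = (a' : ℕ) % M := by
        have e : ((a : ℕ) + 1) % M = ((a' : ℕ) + 1) % M := by
          rw [Nat.mod_eq_zero_of_dvd ha.2, Nat.mod_eq_zero_of_dvd ha'.2]
        exact Nat.ModEq.add_right_cancel' 1 e
      apply Fin.ext
      rw [← Nat.div_add_mod (a : ℕ) M, ← Nat.div_add_mod (a' : ℕ) M, h1]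
      simp only at h
      rw [h]
  simpa using key

/-- `#{a < N | a + 1 = N} ≤ 1`. [folklore] -/
theorem card_filter_succ_eq_le_one (N : ℕ) :
    (Finset.univ.filter fun a : Fin N => (a : ℕ) + 1 = N).card ≤ 1 :=
  Finset.card_le_one.2 fun a ha b hb => by
    rw [Finset.mem_filter] at ha hb
    apply Fin.ext; omega

/-! ### The periodic step relation -/

/-- **A free step is a periodic step.** [folklore] -/
theorem tstep_of_step {N : ℕ} {i : Fin 2} {X Y : FermionTorus 2 N}
    (h : (Fin.val ∘ ofLex Y) = (Fin.val ∘ ofLex X) + Pi.single i 1) :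
    FermionTorus.toTorusSite Y = FermionTorus.toTorusSite X + Pi.single i 1 := by
  funext j
  rw [Pi.add_apply, FermionTorus.toTorusSite_apply, FermionTorus.toTorusSite_apply, coord_of_step h j,
    Pi.single_apply]
  push_cast
  split_ifs <;> simp

/-- **A periodic step that is not a free step starts on the seam `X_i + 1 = N`.** [folklore] -/
theorem coord_eq_of_tstep_of_not_step {N : ℕ} {i : Fin 2} {X Y : FermionTorus 2 N}
    (ht : FermionTorus.toTorusSite Y = FermionTorus.toTorusSite X + Pi.single i 1)
    (hs : ¬ (Fin.val ∘ ofLex Y) = (Fin.val ∘ ofLex X) + Pi.single i 1) : (ofLex X i : ℕ) + 1 = N := by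
  by_contra hne
  apply hs
  have hXi := (ofLex X i).isLt
  funext j
  have hj := congrFun ht j
  rw [Pi.add_apply, FermionTorus.toTorusSite_apply, FermionTorus.toTorusSite_apply, Pi.single_apply] at hj
  simp only [Function.comp_apply, Pi.add_apply, Pi.single_apply]
  have hYj := (ofLex Y j).isLt
  have hXj := (ofLex X j).isLt
  split_ifs at hj ⊢ with hji
  · subst hji
    have e : (((ofLex Y j : ℕ) : ZMod N)) = (((ofLex X j : ℕ) + 1 : ℕ) : ZMod N) := by push_cast; exact hj
    rw [ZMod.natCast_eq_natCast_iff', Nat.mod_eq_of_lt hYj, Nat.mod_eq_of_lt (by omega)] at e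
    exact e
  · rw [add_zero] at hj
    have e : (((ofLex Y j : ℕ) : ZMod N)) = (((ofLex X j : ℕ) : ℕ) : ZMod N) := hj
    rw [ZMod.natCast_eq_natCast_iff', Nat.mod_eq_of_lt hYj, Nat.mod_eq_of_lt hXj] at e
    rw [e, add_zero]

/-- Periodic steps are right-unique. [folklore] -/
theorem tstep_right_unique {N : ℕ} [NeZero N] (i : Fin 2) (X Y Y' : FermionTorus 2 N)
    (h : FermionTorus.toTorusSite Y = FermionTorus.toTorusSite X + Pi.single i 1)
    (h' : FermionTorus.toTorusSite Y' = FermionTorus.toTorusSite X + Pi.single i 1) : Y = Y' :=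
  FermionTorus.equivTorusSite.injective (h.trans h'.symm)

/-- The periodic step from `X` in direction `i` ends at `ofTorusSite (toTorusSite X + e_i)`. [folklore] -/
theorem tstep_iff_eq {N : ℕ} [NeZero N] (i : Fin 2) (X Y : FermionTorus 2 N) :
    FermionTorus.toTorusSite Y = FermionTorus.toTorusSite X + Pi.single i 1 ↔
      Y = FermionTorus.ofTorusSite (FermionTorus.toTorusSite X + Pi.single i 1) := by
  constructor
  · intro h
    rw [← h, FermionTorus.ofTorusSite_toTorusSite]
  · intro h
    rw [h, FermionTorus.toTorusSite_ofTorusSite]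

/-- **Periodic bond sums as indicator sums**: `Σ_{x ∈ (ℤ/N)²} F(x̂, (x + e_i)^) = Σ_X Σ_Y [tst i X Y] F(X,Y)`
(`x̂ = ofTorusSite x`). [folklore] -/
theorem sum_torusSite_eq_sum_sum_ite {N : ℕ} [NeZero N] {A : Type*} [AddCommMonoid A] (i : Fin 2)
    (F : FermionTorus 2 N → FermionTorus 2 N → A) :
    ∑ x : TorusSite 2 N, F (FermionTorus.ofTorusSite x) (FermionTorus.ofTorusSite (x + Pi.single i 1)) =
      ∑ X : FermionTorus 2 N, ∑ Y : FermionTorus 2 N,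
        if FermionTorus.toTorusSite Y = FermionTorus.toTorusSite X + Pi.single i 1 then F X Y else 0 := by
  refine Fintype.sum_equiv FermionTorus.equivTorusSite.symm _ _ fun x => ?_
  change F _ _ = ∑ Y : FermionTorus 2 N, if FermionTorus.toTorusSite Y =
    FermionTorus.toTorusSite (FermionTorus.ofTorusSite x) + Pi.single i 1 then F (FermionTorus.ofTorusSite x) Y else 0
  rw [Finset.sum_eq_single (FermionTorus.ofTorusSite (x + Pi.single i 1))]
  · rw [if_pos]
    rw [FermionTorus.toTorusSite_ofTorusSite, FermionTorus.toTorusSite_ofTorusSite]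
  · intro Y _ hY
    rw [if_neg]
    intro h
    apply hY
    rw [(tstep_iff_eq i _ Y).1 h, FermionTorus.toTorusSite_ofTorusSite]
  · intro h
    exact absurd (Finset.mem_univ _) h

/-- `#{(X,Y) | tst i X Y ∧ P X} ≤ #{X | P X}` — periodic steps are right-unique. [folklore] -/
theorem card_filter_tstep_le {N : ℕ} [NeZero N] (i : Fin 2) (P : FermionTorus 2 N → Prop) [DecidablePred P] :
    ((Finset.univ ×ˢ Finset.univ).filter fun q : FermionTorus 2 N × FermionTorus 2 N =>
      FermionTorus.toTorusSite q.2 = FermionTorus.toTorusSite q.1 + Pi.single i 1 ∧ P q.1).card ≤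
      (Finset.univ.filter P).card := by
  refine Finset.card_le_card_of_injOn Prod.fst (fun q hq => ?_) (fun q hq q' hq' h => ?_)
  · rw [Finset.coe_filter] at hq ⊢
    exact ⟨Finset.mem_univ _, hq.2.2⟩
  · rw [Finset.coe_filter] at hq hq'
    exact Prod.ext h (tstep_right_unique i q.1 q.2 q'.2 hq.2.1 (h ▸ hq'.2.1))

/-! ### Summary (registered sub-goal of stmt-HubbardSuperconductivity-15581) -/

/-- **Registered sub-goal `spl_blockGeometry`** (layer 3 of `stub_sourcedPressureLimit`): block embeddings
of the vertex sets exist, and periodic bond sums are indicator sums of the periodic step. [folklore] -/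
theorem spl_blockGeometry : (∀ (M N : ℕ) (p : Fin 2 → ℕ), (∀ j, p j + M ≤ N) → ∃ f : FermionTorus 2 M ↪o FermionTorus 2 N, ∀ X j, (ofLex (f X) j : ℕ) = p j + (ofLex X j : ℕ)) ∧ (∀ (N : ℕ) [NeZero N] (A : Type) [AddCommMonoid A] (i : Fin 2) (F : FermionTorus 2 N → FermionTorus 2 N → A), ∑ x : Literature.Probability.LatticeModels.TorusSite 2 N, F (FermionTorus.ofTorusSite x) (FermionTorus.ofTorusSite (x + Pi.single i 1)) = ∑ X : FermionTorus 2 N, ∑ Y : FermionTorus 2 N, if FermionTorus.toTorusSite Y = FermionTorus.toTorusSite X + Pi.single i 1 then F X Y else 0) :=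
  ⟨fun _ _ p hp => exists_blockEmb p hp, fun _ _ _ _ i F => sum_torusSite_eq_sum_sum_ite i F⟩

end Summit.HubbardSuperconductivity.HubbardSuperconductivity.Theorems.TwSeededEnsembleEquivalenceR.ColdFloorLine
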